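import Summits.CriticalPhenomena.CardyFormulaZ2.Theorems.CardyComplexConeParafermionToSLESixFamiliesPercKSBoxFaceReduction
import Literature.Probability.Percolation.BondInterfaceFaceDomainULC
import HarnessLib

/-!
# `PercKSBoxData`: only (K1) and box tightness remain

Route `CardyComplexCone` (sub-problem `CriticalPhenomena/CardyFormulaZ2`), crux
`Summit.CriticalPhenomena.CardyFormulaZ2.Theses.CardyComplexCone.ParafermionToSLESixFamilies`
(item stmt-CriticalPhenomena-11389), line `caratheodory-net-slit-uniformity`, stub
`stub_percKSBoxData : PercKSBoxData`. Sequel of `…PercKSBoxFaceReduction.lean`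
(`percKSBoxData_of_face : PercFaceKernel → PercFaceBoxTight → PercKSBoxData`): the (ULC) half of
`PercFaceKernel` is now a theorem of the tree (`hlc_orientedFaceDomain`,
`Literature/Probability/Percolation/BondInterfaceFaceDomainULC.lean`), so the geometric input
shrinks to its (K1) half, isolated here as `PercFaceK1` — every compact subset of the Jordan
domain lies in the oriented face domains of the data of small admissible mesh — with the glue
`percFaceKernel_of_K1 : PercFaceK1 → PercFaceKernel` and
`percKSBoxData_of_K1 : PercFaceK1 → PercFaceBoxTight → PercKSBoxData` PROVED.
-/

noncomputable section

open scoped Topology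
open Filter Set Metric
open Literature.Probability Literature.Probability.LatticeModels Literature.Probability.Percolation
open Literature.Probability.RandomPlanarGeometry

namespace Summit.CriticalPhenomena.CardyFormulaZ2.Cruxes.ParafermionToSLESixFamilies.CaratheodoryNetSlitUniformity

/-- **(K1) for the oriented face domains of a discretisation family**: for every Dobrushin
domain `(D; a, b)`, discretisation family `Λ` and positive admissible meshes `δ_k → 0`, every
compact subset of `D` lies in the oriented face domain of `Λ δ_k` for all large `k` — the kernel
hypothesis `hK1` of `MarkedDomain.exists_uniformizers_of_kernel(_of_isChordalUniformizing)`
(Pommerenke 1992, §1.4, kernel convergence) for these polygonal approximations. Plane geometry of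
the lattice approximation of a Jordan domain (the largest component of the mesh graph contains
the deep lattice points, and the inner faces about a compact are edge-connected to the face at
`e_a` for small mesh); the one remaining unformalised geometric input of `PercKSBoxData`. -/
def PercFaceK1 : Prop :=
  ∀ (D : DobrushinDomain) (Λ : ℝ → DiscreteDobrushin) (hΛ : ZdDiscretisationFamily D Λ)
    (δs : ℕ → ℝ), (∀ k, 0 < δs k) → Tendsto δs atTop (𝓝 0) →
    ∀ hadm : ∀ k, (Λ (δs k)).IsZdAdmissible,
    ∀ K : Set ℂ, IsCompact K → K ⊆ D.carrier →
      ∀ᶠ k in atTop, K ⊆ (orientedFaceDomain hΛ (hadm k)).carrier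

/-- **(K1) alone gives `PercFaceKernel`**: its (ULC) conjunct is the theorem
`hlc_orientedFaceDomain`. -/
theorem percFaceKernel_of_K1 : PercFaceK1 → PercFaceKernel :=
  fun h D Λ hΛ δs hpos hlim hadm ↦
    ⟨h D Λ hΛ δs hpos hlim hadm, hlc_orientedFaceDomain hΛ hlim hadm⟩

/-- **`PercKSBoxData` from (K1) and box tightness** (`percKSBoxData_of_face` with
`percFaceKernel_of_K1`). -/
theorem percKSBoxData_of_K1 : PercFaceK1 → PercFaceBoxTight → PercKSBoxData :=
  fun h1 h2 ↦ percKSBoxData_of_face (percFaceKernel_of_K1 h1) h2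

end Summit.CriticalPhenomena.CardyFormulaZ2.Cruxes.ParafermionToSLESixFamilies.CaratheodoryNetSlitUniformity

end
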